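import Summits.HodgeConjecture.HodgeConjecture.Theorems.F0P3XiPinSphericalOfSqIntNotSpherical     -- ★ (F0P3-p03): XP ⟸ (SqNS), and its ★ inputs (`exists_spherical_constituent`, Tate 3.2.1 bridges)
import Summits.HodgeConjecture.HodgeConjecture.Theorems.F0P3SqIntNotSphericalNonsplitCofinite     -- ★ p833536 (B-p08 (g23)): SqNS♭ body, hypothesis-free (road (B))
import HarnessLib

/-!
# LETTER #79 «XP» `Rogawski1990.XiPinSphericalCofinite` IS A THEOREM — `πⁿ(ξ_v)` is `U(Φ₃)(𝒪_v)`-spherical at almost every non-split place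

Cell `hodgecm-mathlib`, F0∕P3 «U3-mult», crux H413 (`stmt-HodgeConjecture-24833`), floor-0 socket `F0HJ3a` (`stmt-HodgeConjecture-27456`, closer
`Cruxes/H413/Lines/F0_U3LettersRung1.lean`, REGISTERED STUB `stub_79 : ∀ L, XiPinSphericalCofinite L`); fan-B row #79 (XP), typed by B-p08 (g19) ★ p819257
as a LETTER because its in-house road needed «square-integrable ⇒ not `K_v`-spherical» — which road (B) has now made a theorem at the non-split places
(★ p833536 `F0P3SqIntNotSphericalNonsplitCofinite.squareIntegrableNotSpherical_nonsplit_cofinite`, over B-p08 (g20) L3∕L4, A-p03 (g22) (L2-gen)∕(L1)∕(L1b),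
B-p08 (g23) (L5-gen)∕(L5-CM)).  Seat B-p08 (g23).  PROOF LANE: theorems only; no `def`, no instance, no notation, no `sorry`.

THE ARGUMENT is ★ `F0P3XiPinSphericalOfSqIntNotSpherical.xiPinSphericalCofinite_of_eventually_not_isSpherical_of_isSquareIntegrable` VERBATIM, except that its
hypothesis `hSq` is only ever applied under the non-split guard `hns` — so the GUARDED form SqNS♭ (★ p833536) suffices: at a place `v` in the intersection of
the four cofinite sets (SqNS♭; `μω` unramified above `v` ★ `HeckeCharacter.isUnramifiedAt_cofinite_holds` + ★ `eventually_forall_placesOver`; `η`, `ψ` trivial on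
the `v`-units ★ `eventually_torusLocalComponent_eq_one`), if `v` is non-split, the `K_v`-spherical admissible constituent of `i_G(χ_ξ,v)` (★
`F0P3XiUnramNonsplitInstance.exists_spherical_constituent`, [Rogawski1990 §4.5; Bump1997 Prop. 4.2.3]) is `πn` or `πs` by the Keys labels, and it is not the
square-integrable `πs` by SqNS♭ — hence `πn` is spherical.

* `xiPinSphericalCofinite_of_nonsplit_cofinite` — XP from the GUARDED local fact (hypothesis = ★ p833536's statement, token for token);
* **`xiPinSphericalCofinite_holds : ∀ (L : Type) [Field L] [NumberField L] [IsCMField L], XiPinSphericalCofinite L`** — LETTER #79 DISCHARGED, hypothesis-free;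
* `stub_79` — the same theorem under the REGISTERED STUB's verbatim header (socket 27456), for the closer's next edition to fold BY NAME
  (`stub_79 := F0P3XiPinSphericalCofiniteHolds.stub_79`, or `… := fun L _ _ _ => xiPinSphericalCofinite_holds L`).

Print: [Rogawski1990] Thm. 13.3.6 (b) p. 202 («`⊗ πⁿ(ξ_v)` occurs discretely with multiplicity one»), §12.2 case (2) pp. 173–174; [FlathCorvallis1979] Thm. 3;
[Macdonald1971] Ch. V §3; [Casselman1980] §4.  NOTE: print proves XP GLOBALLY (automorphy + Flath); the tree's proof is LOCAL (Bruhat–Tits tree of the rank-one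
group: a `K_v`-spherical class is never square-integrable modulo the centre), valid at every non-split place unramified in `L`, dyadic places included.
HONEST LABEL: HC_CM is proved only modulo the printed citations (2 named inputs hLiu418, h413 remain; behind them the booked printed statements) until rung 0
closes; this file discharges ONE booked letter (#79) and is otherwise silent about HC_CM.
-/

set_option autoImplicit false
set_option linter.dupNamespace false

noncomputable section

open NumberField IsDedekindDomain MeasureTheory Filter

namespace Summit.HodgeConjecture.HodgeConjecture.Cruxes.H413.F0P3XiPinSphericalCofiniteHolds

open Literature.NumberTheory Literature.NumberTheory.Automorphic Literature.NumberTheory.Automorphic.UnitaryGroup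
open Literature.NumberTheory.Rogawski1990 Literature.NumberTheory.GaloisRepresentations
open Summit.HodgeConjecture.HodgeConjecture.Cruxes.H413.F0P3XiLocalFamilyOfRecord (eventually_torusLocalComponent_eq_one semilocalComponent_eq_one_of_forall_isUnramifiedAt)

variable (L : Type) [Field L] [NumberField L] [IsCMField L]

/-- **XP from the GUARDED local fact SqNS♭**: if, for all but finitely many finite places `v` of `L⁺` THAT DO NOT SPLIT in `L`, no square-integrable-mod-centre class of
`U(Φ₃)(L⁺_v)` is `U(Φ₃)(𝒪_v)`-spherical (hypothesis `hSq` = ★ `squareIntegrableNotSpherical_nonsplit_cofinite L`'s statement, token for token), then letter #79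
★ `XiPinSphericalCofinite L` holds — the proof of ★ `xiPinSphericalCofinite_of_eventually_not_isSpherical_of_isSquareIntegrable` with `hSq` applied under `hns`.
[cite: Rogawski1990, §12.2 (2) pp. 173–174; Thm. 13.3.6 (b) p. 202] [cite: Macdonald1971, Ch. V §3] [cite: TateThesis1967, Lemma 3.2.1] -/
theorem xiPinSphericalCofinite_of_nonsplit_cofinite
    (hSq : ∀ᶠ v : HeightOneSpectrum (𝓞 ↥(maximalRealSubfield L)) in cofinite,
      (∀ w : PlacesOver L v, IsCMField.complexConj L • w.1 = w.1) →
      ∀ [MeasurableSpace (Gqs L v ⧸ Subgroup.center (Gqs L v))] [BorelSpace (Gqs L v ⧸ Subgroup.center (Gqs L v))]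
        (μZ : Measure (Gqs L v ⧸ Subgroup.center (Gqs L v))) [μZ.IsHaarMeasure] (c : IrrClass (Gqs L v)),
        c.IsSquareIntegrable μZ → ¬ c.IsSpherical (cmLocalIntegralLevel L 3 (qsForm L) v)) :
    XiPinSphericalCofinite L := by
  intro μω _hμu ξ
  filter_upwards [hSq, eventually_forall_placesOver (F := ↥(maximalRealSubfield L)) L (HeckeCharacter.isUnramifiedAt_cofinite_holds μω),
    eventually_torusLocalComponent_eq_one L ξ.η, eventually_torusLocalComponent_eq_one L ξ.ψ] with v hv hμ hη hψ
  intro hns _hquad _ _ μZ _ πs πn hK hs _hn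
  -- THE spherical admissible constituent of `i_G(χ_ξ,v)` (unramified data at `v`: Tate 3.2.1 bridges)
  obtain ⟨r, hrc, -, hr1, -⟩ := F0P3XiUnramNonsplitInstance.exists_spherical_constituent L v (μω.semilocalComponent L v)
    (torusLocalComponent L (IsCMField.complexConj L) v ξ.η) (torusLocalComponent L (IsCMField.complexConj L) v ξ.ψ)
    (semilocalComponent_eq_one_of_forall_isUnramifiedAt L v μω hμ) (fun t _ => hη hns t) (fun t _ => hψ hns t)
  have hsph : (IrrClass.mk r).IsSpherical (cmLocalIntegralLevel L 3 (qsForm L) v) := (IrrClass.isSpherical_mk r _).2 hr1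
  -- it is `πn` or `πs` (Keys' labels), and `πs` is square-integrable hence not spherical (SqNS♭ at the non-split `v`)
  rcases (hK.2 (IrrClass.mk r)).1 hrc with h | h
  · exact h ▸ hsph
  · exact absurd (h ▸ hsph) (hv hns μZ πs hs)

/-- **LETTER #79 «XP» IS A THEOREM**: for every CM field `L`, ★ `Rogawski1990.XiPinSphericalCofinite L` — for every unitary Hecke character `μω` and every
one-dimensional automorphic `ξ` of `U(2) × U(1)`, at all but finitely many non-split places the non-square-integrable Keys constituent `πⁿ(ξ_v)` of `i_G(χ_{ξ,v})` is
`U(Φ₃)(𝒪_v)`-spherical.  Hypothesis-free: `xiPinSphericalCofinite_of_nonsplit_cofinite` at ★ p833536 `squareIntegrableNotSpherical_nonsplit_cofinite` (road (B)).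
[cite: Rogawski1990, Thm. 13.3.6 (b) p. 202; §12.2 (2) pp. 173–174] [cite: FlathCorvallis1979, Thm. 3] [cite: Macdonald1971, Ch. V §3] [cite: Casselman1980, §4] -/
theorem xiPinSphericalCofinite_holds : ∀ (L : Type) [Field L] [NumberField L] [IsCMField L], XiPinSphericalCofinite L :=
  fun L _ _ _ => xiPinSphericalCofinite_of_nonsplit_cofinite L
    (F0P3SqIntNotSphericalNonsplitCofinite.squareIntegrableNotSpherical_nonsplit_cofinite L)

/-- **REGISTERED STUB #79 of socket `F0HJ3a` (closer `Cruxes/H413/Lines/F0_U3LettersRung1.lean` :685), verbatim header, now PROVED** —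
★ `Rogawski1990.XiPinSphericalCofinite` at every CM field (`xiPinSphericalCofinite_holds`). [cite: Rogawski1990, Thm. 13.3.6 (b) p. 202; §12.2 (2) pp. 173–174] -/
theorem stub_79 : ∀ (L : Type) [Field L] [NumberField L] [IsCMField L], XiPinSphericalCofinite L :=
  xiPinSphericalCofinite_holds

end Summit.HodgeConjecture.HodgeConjecture.Cruxes.H413.F0P3XiPinSphericalCofiniteHolds

end
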